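import Literature.NumberTheory.Automorphic.UnitaryGroupHeisenbergPartSplit
import Literature.NumberTheory.Automorphic.UnitaryGroupHeisenbergPartTorusIntegral
import HarnessLib

/-!
# The Heisenberg part of the unipotent term: the (E-GN) stage
# `∫_G β ψʳ_T dν_G = C · J(T)`, `J(T) = ∫_T (w_T(t) δ_B(t)⁻¹) ∫_{n ∈ Ω_N} ∫_K ψʳ_T(n (t k)) dμ_K dμ_N dμ_T`, for `T ≫ 0`
(Rogawski (1990), proof of Prop. 7.3.2, p. 96; Arthur (1981), §2)

Topic `NumberTheory/Automorphic`; namespace `Literature.NumberTheory.Automorphic.UnitaryGroup`. THEOREMS ONLY over accepted tree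
modules (no definition, no named fact, no instance, no notation, no `sorry`). Row (E-GN) HEAD of the Heisenberg part (E) of the unipotent
term `P_{z·𝒰}` (LAW 5 road of `Cruxes/H413/Lines/F0_T1InnerFormTraceIdentity.lean`, crux H413; cell hodgecm-mathlib): the binder `hEGN` of
★ `heisPart_integral_eq_linear_of_stages` (`UnitaryGroupHeisenbergPartAssembly`, B-p17 (g19)) for the Heisenberg piece

  `ψʳ_T(g) := Σ'_{ξ ∈ E^×} Σ'_{w ∈ E⁻} f(g⁻¹ (z₁ u(ξ, w)) g) − 1_{T < H(g)} K_{B,𝔬}(g, g)`  (INLINE, ★ B1 letters),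

composed from ★ (E-G) `UnitaryGroupHeisenbergPartSplit` (measurability, left-`B(F)`-invariance from `hCinv`, `∫⁻ β‖ψʳ_T‖ₑ < ∞` from the
(HINT) finiteness and `hCfin`) and ★ (E-w) `UnitaryGroupHeisenbergPartTorusIntegral` (`exists_integral_weight_eq_integral_torus_heisBox`).

* `integrable_toReal_smul_of_lintegral_lt_top` — `∫⁻ β ‖ψ‖ₑ < ∞ ⇒ Integrable ((β ·).toReal • ψ)` for measurable `β`, `ψ`.
* **`exists_heisPart_integral_eq_torus`** — `∃ C > 0, ∃ T₁, ∀ T > T₁, Integrable (β•ψʳ_T) ν_G ∧ ∫_G β ψʳ_T dν_G = C · J(T)` with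
  `J(T) = ∫_T (w_T(t) δ_B(t)⁻¹) • ∫_{n ∈ Ω_N} ∫_K ψʳ_T(n (t k)) dμ_K ∂heisHaar dμ_T`, GIVEN `hCinv`, `hCfin` (owed by the (C) assembly) and
  `hHint : ∃ T₀, ∀ T > T₀, ∫⁻ β ‖ψ_T‖ₑ < ∞` (★ A-p13 `exists_forall_lintegral_weight_mul_enorm_bracket_lt_top` under the (F) integrability `hkint`).

## References
* J. D. Rogawski, *Automorphic Representations of Unitary Groups in Three Variables*, Ann. of Math. Stud. 123 (1990), §7.3 Prop. 7.3.2
  (pp. 95–97) [Rogawski1990].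
* J. Arthur, *The trace formula in invariant form*, Ann. of Math. 114 (1981), §2 [Arthur1981TraceFormulaInvariantForm].
-/

set_option autoImplicit false

noncomputable section

open MeasureTheory MeasureTheory.Measure Set Filter Function NumberField IsDedekindDomain Polynomial Topology
  Literature.MeasureTheory.Group
open scoped ENNReal NNReal Topology MatrixGroups

namespace Literature.NumberTheory.Automorphic

namespace UnitaryGroup

/-! ## §1 Integrability on `G(𝔸)` from the weighted `[0, ∞]` bound -/

/-- **`∫⁻ β ‖ψ‖ₑ < ∞ ⇒ (β ·).toReal • ψ` is integrable** (measurable `β`, `ψ`): `‖(β g).toReal • ψ g‖ₑ ≤ β g ‖ψ g‖ₑ`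
(`ENNReal.ofReal_toReal_le`). [cite: Arthur1981TraceFormulaInvariantForm, §2] -/
theorem integrable_toReal_smul_of_lintegral_lt_top {G : Type*} [MeasurableSpace G] {ν : Measure G}
    {V : Type*} [NormedAddCommGroup V] [NormedSpace ℝ V] [MeasurableSpace V] [BorelSpace V] [SecondCountableTopology V]
    {β : G → ℝ≥0∞} (hβm : Measurable β) {ψ : G → V} (hψm : Measurable ψ) (hint : ∫⁻ g, β g * ‖ψ g‖ₑ ∂ν < ∞) :
    Integrable (fun g => (β g).toReal • ψ g) ν := by
  refine ⟨(hβm.ennreal_toReal.smul hψm).aestronglyMeasurable, ?_⟩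
  refine lt_of_le_of_lt (lintegral_mono fun g => ?_) hint
  rw [enorm_smul]
  gcongr
  rw [Real.enorm_eq_ofReal ENNReal.toReal_nonneg]
  exact ENNReal.ofReal_toReal_le

variable {F E : Type} [Field F] [NumberField F] [Field E] [NumberField E] [Algebra F E]
  {c : E ≃ₐ[F] E} {ι : Type*}

/-! ## §2 The (E-GN) stage for `ψʳ_T` -/

section Stage

variable (ζ : ratOne F E c) {z₁ : (quasiSplit F E c 3).arithmeticSubgroup}
  [MeasurableSpace (quasiSplit F E c 3).Adelic] [BorelSpace (quasiSplit F E c 3).Adelic]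
  [MeasurableSpace (AdeleRing (𝓞 E) E)] [BorelSpace (AdeleRing (𝓞 E) E)] [LocallyCompactSpace (AdeleRing (𝓞 E) E)]
  [MeasurableSpace (adelicUnipotent F E c 3)] [BorelSpace (adelicUnipotent F E c 3)]

/-- **THE (E-GN) STAGE** — the binder `hEGN` of ★ `heisPart_integral_eq_linear_of_stages`: for the Heisenberg piece `ψʳ_T` of the bracket
of the unipotent term (★ B1 letters; split ★ `bracket_eq_centrePart_add_heisPart`), GIVEN the (C)-side exports `hCinv` (left
`B(F)`-invariance of the centre piece) and `hCfin : ∫⁻ β‖ψᶜ‖ₑ < ∞`, and the (HINT) finiteness family `hHint`: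

  `∃ C > 0, ∃ T₁, ∀ T > T₁, Integrable (β•ψʳ_T) ν_G ∧ ∫_G β ψʳ_T dν_G = C · ∫_T (w_T(t) δ_B(t)⁻¹) • ∫_{n ∈ Ω_N} ∫_K ψʳ_T(n (t k)) dμ_K ∂heisHaar dμ_T`

(★ (E-G) `measurable_heisPart` ∕ `heisPart_rational_borel_mul_of_centrePart` ∕ `lintegral_weight_mul_enorm_heisPart_lt_top`, ★ (E-w)
`exists_integral_weight_eq_integral_torus_heisBox`). [cite: Rogawski1990, §7.3 Prop. 7.3.2 (pp. 95–97)] [cite: Arthur1981TraceFormulaInvariantForm, §2] -/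
theorem exists_heisPart_integral_eq_torus {cl : (quasiSplit F E c 3).arithmeticSubgroup → ι} (hc : c * c = 1) (hc1 : c ≠ 1)
    (hz₁ : (z₁ : (quasiSplit F E c 3).Adelic) =
      (quasiSplit F E c 3).toAdelic (ratCenter F E c 3 ((StdForm.antidiagonal 3).over E) ζ))
    (hclN : IsUnipotentInvariantOnBorel F E c 3 cl)
    (ν : Measure (adelicUnipotent F E c 3)) [ν.IsHaarMeasure]
    {𝓕 : Set (adelicUnipotent F E c 3)} (h𝓕 : IsFundamentalDomain (rationalUnipotent F E c 3) 𝓕 ν) (i : ι)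
    {f : (quasiSplit F E c 3).Adelic → ℂ} (hfc : Continuous f) (hf : HasCompactSupport f)
    (νG : Measure (quasiSplit F E c 3).Adelic) [νG.IsHaarMeasure]
    (μB : Measure (borelAdelic F E c 3)) [μB.IsHaarMeasure]
    (μK : Measure ((standardMaximalCompactGL 3 E).comap
      (adelicVal F E c 3 ((StdForm.antidiagonal 3).over E)) : Subgroup (quasiSplit F E c 3).Adelic))
    [μK.IsHaarMeasure]
    (hBK : ∀ g : (quasiSplit F E c 3).Adelic, ∃ b ∈ borelAdelic F E c 3, ∃ k : (quasiSplit F E c 3).Adelic,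
      adelicVal F E c 3 ((StdForm.antidiagonal 3).over E) k ∈ standardMaximalCompactGL 3 E ∧ g = b * k)
    (μT : Measure (torusInBorel F E c 3)) [μT.IsHaarMeasure]
    (μX : Measure (AdeleRing (𝓞 E) E)) [μX.IsAddHaarMeasure]
    (μY : Measure (traceZeroAdele F E c)) [μY.IsAddHaarMeasure]
    {wT : torusInBorel F E c 3 → ℝ≥0∞}
    (hwT : IsCoveringWeight ((((quasiSplit F E c 3).arithmeticSubgroup).subgroupOf (borelAdelic F E c 3)).subgroupOf
      (torusInBorel F E c 3)) wT)
    {β : (quasiSplit F E c 3).Adelic → ℝ≥0∞}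
    (hβ : IsCoveringWeight ((arithmeticBorel F E c 3).map (quasiSplit F E c 3).arithmeticSubgroup.subtype) β)
    (hCinv : ∀ b ∈ arithmeticBorel F E c 3, ∀ y : (quasiSplit F E c 3).Adelic,
      (∑' w : {w : rationalTraceZero F E c // w ≠ 0},
        f (((b : (quasiSplit F E c 3).Adelic) * y)⁻¹ * ((z₁ : (quasiSplit F E c 3).Adelic) *
          (((heisChart hc ((0 : AdeleRing (𝓞 E) E), ((w.1 : rationalTraceZero F E c) : traceZeroAdele F E c))) :
            adelicUnipotent F E c 3) : (quasiSplit F E c 3).Adelic)) * ((b : (quasiSplit F E c 3).Adelic) * y))) =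
      ∑' w : {w : rationalTraceZero F E c // w ≠ 0},
        f (y⁻¹ * ((z₁ : (quasiSplit F E c 3).Adelic) *
          (((heisChart hc ((0 : AdeleRing (𝓞 E) E), ((w.1 : rationalTraceZero F E c) : traceZeroAdele F E c))) :
            adelicUnipotent F E c 3) : (quasiSplit F E c 3).Adelic)) * y))
    (hCfin : ∫⁻ g, β g * ‖∑' w : {w : rationalTraceZero F E c // w ≠ 0},
        f (g⁻¹ * ((z₁ : (quasiSplit F E c 3).Adelic) *
          (((heisChart hc ((0 : AdeleRing (𝓞 E) E), ((w.1 : rationalTraceZero F E c) : traceZeroAdele F E c))) :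
            adelicUnipotent F E c 3) : (quasiSplit F E c 3).Adelic)) * g)‖ₑ ∂νG < ∞)
    (hHint : ∃ T₀ : ℝ≥0, ∀ T : ℝ≥0, T₀ < T →
      ∫⁻ g, β g * ‖(∑' u : {u : rationalUnipotent F E c 3 // u ≠ 1},
        f (g⁻¹ * ((z₁ * ⟨(((u.1 : rationalUnipotent F E c 3) : adelicUnipotent F E c 3) :
          (quasiSplit F E c 3).Adelic), (u.1 : rationalUnipotent F E c 3).2⟩ :
            (quasiSplit F E c 3).arithmeticSubgroup) : (quasiSplit F E c 3).Adelic) * g)) -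
      kernelBorelTailClass ν 𝓕 T cl i f g‖ₑ ∂νG < ∞) :
    ∃ C : ℝ, 0 < C ∧ ∃ T₁ : ℝ≥0, ∀ T : ℝ≥0, T₁ < T →
      Integrable (fun g : (quasiSplit F E c 3).Adelic => (β g).toReal •
        ((∑' ξ : {ξ : E // ξ ≠ 0}, ∑' w : rationalTraceZero F E c,
          f (g⁻¹ * ((z₁ : (quasiSplit F E c 3).Adelic) *
            (((heisChart hc (algebraMap E (AdeleRing (𝓞 E) E) (ξ : E), (w : traceZeroAdele F E c))) :
              adelicUnipotent F E c 3) : (quasiSplit F E c 3).Adelic)) * g)) -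
          kernelBorelTailClass ν 𝓕 T cl i f g)) νG ∧
      ∫ g, (β g).toReal •
        ((∑' ξ : {ξ : E // ξ ≠ 0}, ∑' w : rationalTraceZero F E c,
          f (g⁻¹ * ((z₁ : (quasiSplit F E c 3).Adelic) *
            (((heisChart hc (algebraMap E (AdeleRing (𝓞 E) E) (ξ : E), (w : traceZeroAdele F E c))) :
              adelicUnipotent F E c 3) : (quasiSplit F E c 3).Adelic)) * g)) -
          kernelBorelTailClass ν 𝓕 T cl i f g) ∂νG =
        (C : ℂ) * ∫ t : torusInBorel F E c 3,
          ((wT t).toReal * ((torusRootModulus E 3 (diagUnit (t : borelAdelic F E c 3).2) : ℝ≥0) : ℝ)⁻¹) •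
            ∫ n in heisHomeomorph hc '' (adeleFundamentalDomain E ×ˢ traceZeroFundamentalDomain F E c),
              ∫ k, ((∑' ξ : {ξ : E // ξ ≠ 0}, ∑' w : rationalTraceZero F E c,
                f ((((n : borelAdelic F E c 3) : (quasiSplit F E c 3).Adelic) *
                    (((t : borelAdelic F E c 3) : (quasiSplit F E c 3).Adelic) * (k : (quasiSplit F E c 3).Adelic)))⁻¹ *
                  ((z₁ : (quasiSplit F E c 3).Adelic) *
                    (((heisChart hc (algebraMap E (AdeleRing (𝓞 E) E) (ξ : E), (w : traceZeroAdele F E c))) :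
                      adelicUnipotent F E c 3) : (quasiSplit F E c 3).Adelic)) *
                  (((n : borelAdelic F E c 3) : (quasiSplit F E c 3).Adelic) *
                    (((t : borelAdelic F E c 3) : (quasiSplit F E c 3).Adelic) * (k : (quasiSplit F E c 3).Adelic))))) -
                kernelBorelTailClass ν 𝓕 T cl i f (((n : borelAdelic F E c 3) : (quasiSplit F E c 3).Adelic) *
                  (((t : borelAdelic F E c 3) : (quasiSplit F E c 3).Adelic) * (k : (quasiSplit F E c 3).Adelic)))) ∂μK
              ∂(heisHaar hc μX μY) ∂μT := by
  haveI : T2Space (quasiSplit F E c 3).Adelic :=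
    inferInstanceAs (T2Space (adelic F E c 3 ((StdForm.antidiagonal 3).over E)))
  haveI : SecondCountableTopology (quasiSplit F E c 3).Adelic :=
    inferInstanceAs (SecondCountableTopology (adelic F E c 3 ((StdForm.antidiagonal 3).over E)))
  haveI : LocallyCompactSpace (quasiSplit F E c 3).Adelic :=
    inferInstanceAs (LocallyCompactSpace (adelic F E c 3 ((StdForm.antidiagonal 3).over E)))
  haveI : T2Space (AdeleRing (𝓞 E) E) := t2Space_adeleRing_of_numberField E
  -- `N(𝔸_F)` closed: second countable, locally compact, `ν` s-finite
  have hNcl : IsClosed ((adelicUnipotent F E c 3 : Set (quasiSplit F E c 3).Adelic)) := by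
    change IsClosed (⇑(adelicVal F E c 3 ((StdForm.antidiagonal 3).over E)) ⁻¹'
      ((upperUnitriangular (Fin 3) (AdeleRing (𝓞 E) E) : Subgroup (GL (Fin 3) (AdeleRing (𝓞 E) E))) :
        Set (GL (Fin 3) (AdeleRing (𝓞 E) E))))
    exact (isClosed_upperUnitriangular (R := AdeleRing (𝓞 E) E)).preimage continuous_subtype_val
  haveI : SecondCountableTopology (adelicUnipotent F E c 3) := TopologicalSpace.Subtype.secondCountableTopology _
  haveI : LocallyCompactSpace (adelicUnipotent F E c 3) := hNcl.locallyCompactSpace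
  haveI : SFinite ν := inferInstance
  obtain ⟨C, hC, hmain⟩ := exists_integral_weight_eq_integral_torus_heisBox hc hc1 νG μB μK hBK μT μX μY hwT
  obtain ⟨T₀, hT₀⟩ := hHint
  refine ⟨C, hC, T₀, fun T hT => ?_⟩
  -- the three inputs of ★ (E-w) at `ψ := ψʳ_T`
  have hψm := measurable_heisPart (z₁ := z₁) (cl := cl) hc ν 𝓕 T i hfc
  have hψinv : ∀ b ∈ arithmeticBorel F E c 3, ∀ y : (quasiSplit F E c 3).Adelic,
      (∑' ξ : {ξ : E // ξ ≠ 0}, ∑' w : rationalTraceZero F E c,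
        f (((b : (quasiSplit F E c 3).Adelic) * y)⁻¹ * ((z₁ : (quasiSplit F E c 3).Adelic) *
          (((heisChart hc (algebraMap E (AdeleRing (𝓞 E) E) (ξ : E), (w : traceZeroAdele F E c))) :
            adelicUnipotent F E c 3) : (quasiSplit F E c 3).Adelic)) * ((b : (quasiSplit F E c 3).Adelic) * y))) -
        kernelBorelTailClass ν 𝓕 T cl i f ((b : (quasiSplit F E c 3).Adelic) * y) =
      (∑' ξ : {ξ : E // ξ ≠ 0}, ∑' w : rationalTraceZero F E c,
        f (y⁻¹ * ((z₁ : (quasiSplit F E c 3).Adelic) *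
          (((heisChart hc (algebraMap E (AdeleRing (𝓞 E) E) (ξ : E), (w : traceZeroAdele F E c))) :
            adelicUnipotent F E c 3) : (quasiSplit F E c 3).Adelic)) * y)) -
        kernelBorelTailClass ν 𝓕 T cl i f y :=
    fun b hb y => heisPart_rational_borel_mul_of_centrePart ζ hc hc1 hz₁ hclN ν h𝓕 T hfc hf i hCinv b hb y
  have hψint := lintegral_weight_mul_enorm_heisPart_lt_top (z₁ := z₁) (cl := cl) hc ν 𝓕 T i hfc hf νG hβ.measurable
    (hT₀ T hT) hCfin
  obtain ⟨-, hval⟩ := hmain hβ hψm hψinv hψint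
  exact ⟨integrable_toReal_smul_of_lintegral_lt_top hβ.measurable hψm hψint, hval⟩

end Stage

end UnitaryGroup

end Literature.NumberTheory.Automorphic

end
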